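import Mathlib.NumberTheory.ArithmeticFunction.Liouville
import Mathlib.NumberTheory.ArithmeticFunction.Moebius
import Mathlib.Analysis.SpecialFunctions.Pow.Real
import Mathlib.Analysis.SpecialFunctions.Log.Basic
import Literature.Computability.Complexity.Circuit
import Literature.Computability.Complexity.ConstantDepth
import Literature.Computability.Complexity.BoolEncodings
import HarnessLib

/-!
# Möbius/Liouville versus Walsh characters and bounded-depth circuits (named facts)

Published, unformalised results on the Fourier–Walsh spectrum of the Möbius function `μ`
restricted to `{0, …, 2ⁿ - 1} ≃ {0,1}ⁿ` (binary digits, `x = Σ_j x_j 2^j`, i.e. the tree's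
little-endian `bitsToNat (List.ofFn x)`), and on its non-correlation with bounded-depth circuits,
vendored AS PRINTED as `def … : Prop` named facts (CONVENTIONS §4):

* `green_moebius_ACd` — Green 2012, Theorem 1: an `AC⁰(d)` function `F : {0,…,N-1} → {±1}`
  (circuit of depth `≤ d` and size `≤ n^d` on the `n` binary digits, `N = 2ⁿ`, unbounded fan-in
  `∧/∨/¬`, every gate counted in the depth) has `𝔼_x μ(x) F(x) = O(e^{d log n - c n^{1/(6d)}})`.
* `green_moebius_fourierWalsh` — Green 2012, Proposition 1: `μ̂(S) = O(k e^{-c n^{1/2}/k})`,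
  `|S| = k`.
* `bourgain_moebius_walsh_uniform` — Bourgain 2013 (J. Anal. Math. 119), Theorem 1: for `n`
  large, `max_A |Σ_{x<2ⁿ} μ(x) w_A(x)| < 2^{n - n^{1/10}}` uniformly over ALL Walsh functions
  `w_A(x) = Π_{j∈A} (1 - 2x_j)`.
* `green_liouville_ACd`, `green_liouville_fourierWalsh`, `bourgain_liouville_walsh_uniform` — the
  same statements for the Liouville function `λ`, which both papers assert in print by an explicit remark (Green 2012, §1:
  "All of the results in this paper hold equally well for the Liouville function, with very similar
  proofs"; Bourgain 2013, Thm 1: "(a similar estimate is also valid for the Liouville function)").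
  These three are vendored on the strength of those printed remarks only — flagged in each docstring.

Circuit vocabulary is the tree's (`Literature.Computability.Complexity.Circuit`, `acBasis`,
`Circuit.depth` = longest input–output path with EVERY gate counting `1` — Green counts negation
gates in the depth, so we use `depth`, not `acDepth` —, `Circuit.size` = number of gates,
`Circuit.eval`). The sign convention `F(x) = +1 ↔ C.eval x = true` is immaterial (the bounds are
on absolute values and `F ↦ -F` preserves them). `μ(0) = 0` as in Green (Mathlib's arithmetic
functions vanish at `0`); likewise `λ(0) = 0`. Digit order is immaterial as well (relabelling the
inputs of a circuit preserves depth and size; for Walsh functions it relabels `A`).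

What is NOT here: Green's Theorem 2 (Linial–Mansour–Nisan, proved in the tree in Tal's sharper
form `Circuit.l1Level_acBasis_le`), Bourgain's GRH Theorem 2, and Bourgain (Israel J. Math. 197)
level-`n^{2/3}` theorem; no consequence such as `L_λ ∉ AC⁰` is derived here (that needs the prime
number theorem for `λ` and codeword bookkeeping and belongs to the consumer).

These facts ground route `PneNP/Mobius`: support `Mobius.LiouvilleNotAC0` (Green's theorem for
`λ`) and the degree-`1` (Walsh) case of crux `Mobius.LiouvilleDigitalPhases` (Bourgain).
-/

namespace Literature.NumberTheory.LFunctions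

open Literature.Computability.Complexity

/-- The (unnormalised) correlation of an arithmetic function `g : ℕ → ℤ` with the `±1`-valued
function computed by a circuit `C` on the `n` binary digits: `Σ_{x ∈ {0,1}ⁿ} g(val x)·(-1)^{¬C(x)}`
with `val x = Σ_j x_j 2^j` (`bitsToNat (List.ofFn x)`) and the convention `C(x) = true ↦ +1`.
Green, Combin. Probab. Comput. 21 (2012) 942, §1 (the quantity `N·𝔼_x μ(x)F(x)`). [folklore] -/
noncomputable def circuitCorrelation {n : ℕ} (g : ℕ → ℤ) (C : Circuit (Fin n)) : ℝ :=
  ∑ x : Fin n → Bool, (g (bitsToNat (List.ofFn x)) : ℝ) * (if C.eval x = true then (1 : ℝ) else -1)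

/-- The (unnormalised) Fourier–Walsh coefficient of an arithmetic function `g : ℕ → ℤ` at
`A ⊆ {0, …, n-1}`: `Σ_{x ∈ {0,1}ⁿ} g(val x) · w_A(x)`, `w_A(x) = Π_{j ∈ A} (1 - 2x_j) = (-1)^{Σ_{j∈A} x_j}`,
`val x = Σ_j x_j 2^j`. This is `2ⁿ·ĝ(A)` in the normalisation of Green 2012, Definition (§1) and
Bourgain 2013, (0.2). [folklore] -/
noncomputable def walshSum {n : ℕ} (g : ℕ → ℤ) (A : Finset (Fin n)) : ℝ :=
  ∑ x : Fin n → Bool, (g (bitsToNat (List.ofFn x)) : ℝ) * ∏ j ∈ A, (if x j = true then (-1 : ℝ) else 1)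

/-- **Green 2012, Theorem 1** (Möbius is orthogonal to `AC⁰(d)` functions). Printed statement:
"Suppose `N = 2ⁿ`. Let `F : {0,…,N-1} → {-1,1}` be an `AC⁰(d)` function [computed from the `n`
binary digits of `x` by a circuit of unbounded fan-in AND/OR/NOT gates of depth at most `d` — the
maximal length of a path from an input to the output — and size (total number of gates) at most
`n^d`]. Then `𝔼_{0 ≤ x ≤ N-1} μ(x)F(x) = O(e^{d log n - c n^{1/6d}})`, where `c > 0` is an absolute
constant." Here with an explicit absolute implied constant `K`, `d ≥ 1`, `n ≥ 1`, Green's depth =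
`Circuit.depth` (every gate, negations included, counts `1`), size = `Circuit.size`, and `μ(0) = 0`
(Green's convention; Mathlib's `ArithmeticFunction.moebius 0 = 0`).
Grounds nothing by itself; see `green_liouville_ACd` for the route `PneNP/Mobius`.
[cite: Green2012, Theorem 1] -/
def green_moebius_ACd : Prop :=
  ∃ c : ℝ, 0 < c ∧ ∃ K : ℝ, ∀ (d n : ℕ), 1 ≤ d → 1 ≤ n →
    ∀ C : Circuit (Fin n), C.IsOver acBasis → C.depth ≤ d → C.size ≤ n ^ d →
      |circuitCorrelation (fun m => ArithmeticFunction.moebius m) C| / 2 ^ n ≤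
        K * Real.exp (d * Real.log n - c * (n : ℝ) ^ (1 / (6 * (d : ℝ))))

/-- **Green 2012, Theorem 1 for the Liouville function** — vendored on the strength of the
printed remark (Green 2012, §1, after Proposition 1): "In the author's opinion it is very slightly
more natural to consider, in place of the Möbius function `μ`, the Liouville function `λ` … All of
the results in this paper hold equally well for the Liouville function, with very similar proofs."
Same shape as `green_moebius_ACd` with `λ = ArithmeticFunction.liouville` (`λ(0) = 0`).
Grounds `Summit.PneNP.PneNP.Theses.Mobius.LiouvilleNotAC0` (together with `Σ_{x<N} λ(x) = o(N)`
and the codeword bookkeeping of `encodingNatBool`, which are NOT part of this fact).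
[cite: Green2012, Theorem 1 and §1 remark on λ] -/
def green_liouville_ACd : Prop :=
  ∃ c : ℝ, 0 < c ∧ ∃ K : ℝ, ∀ (d n : ℕ), 1 ≤ d → 1 ≤ n →
    ∀ C : Circuit (Fin n), C.IsOver acBasis → C.depth ≤ d → C.size ≤ n ^ d →
      |circuitCorrelation (fun m => ArithmeticFunction.liouville m) C| / 2 ^ n ≤
        K * Real.exp (d * Real.log n - c * (n : ℝ) ^ (1 / (6 * (d : ℝ))))

/-- **Green 2012, Proposition 1** (Fourier–Walsh coefficients of Möbius). Printed statement:
"Suppose that `S ⊆ {1,…,n}` has size `|S| = k`. Then `μ̂(S) = O(k e^{-c n^{1/2}/k})`, where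
`c > 0` is some absolute constant", with `μ̂(S) := 𝔼_{0 ≤ x ≤ N-1} μ(x)(-1)^{Σ_{i∈S} x_i}`,
`N = 2ⁿ`, `x = x_1 + 2x_2 + ⋯ + 2^{n-1}x_n`. Here with an explicit implied constant `K`, digits
indexed by `Fin n` (`j ↦ 2^j`), `k ≥ 1` (`S` nonempty; for `S = ∅` the printed bound is void).
[cite: Green2012, Proposition 1] -/
def green_moebius_fourierWalsh : Prop :=
  ∃ c : ℝ, 0 < c ∧ ∃ K : ℝ, ∀ n : ℕ, 1 ≤ n → ∀ S : Finset (Fin n), S.Nonempty →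
    |walshSum (fun m => ArithmeticFunction.moebius m) S| / 2 ^ n ≤
      K * S.card * Real.exp (-(c * Real.sqrt n / S.card))

/-- **Bourgain 2013 (J. Anal. Math. 119), Theorem 1** (uniform Möbius–Walsh bound, answering
Kalai's question). Printed statement: "For `λ` large enough,
`max_{A ⊆ {0,…,λ-1}} |Σ_{n < 2^λ} μ(n) w_A(n)| < 2^{λ - λ^{1/10}}` (a similar estimate is also
valid for the Liouville function)", where `w_A(x) = Π_{j∈A} (1 - 2x_j)`, `x = Σ_{0≤j<λ} x_j 2^j`.
Here the paper's `λ` (number of digits) is `n`, and `μ(0) = 0` contributes nothing.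
[cite: Bourgain2013MoebiusWalsh, Theorem 1] -/
def bourgain_moebius_walsh_uniform : Prop :=
  ∃ n₀ : ℕ, ∀ n : ℕ, n₀ ≤ n → ∀ A : Finset (Fin n),
    |walshSum (fun m => ArithmeticFunction.moebius m) A| <
      (2 : ℝ) ^ ((n : ℝ) - (n : ℝ) ^ ((1 : ℝ) / 10))

/-- **Bourgain 2013 (J. Anal. Math. 119), Theorem 1 for the Liouville function** — vendored on
the strength of the printed parenthetical in the statement of Theorem 1, "(a similar estimate is
also valid for the Liouville function)", and the abstract ("A similar result also holds for the
Liouville function"). Same shape as `bourgain_moebius_walsh_uniform` with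
`λ = ArithmeticFunction.liouville`. This is exactly the degree-`≤ 1` (affine `𝔽₂`-phase = signed
Walsh character) case of crux `Summit.PneNP.PneNP.Theses.Mobius.LiouvilleDigitalPhases`; the
crux for higher degree is open. [cite: Bourgain2013MoebiusWalsh, Theorem 1 (remark on λ)] -/
def bourgain_liouville_walsh_uniform : Prop :=
  ∃ n₀ : ℕ, ∀ n : ℕ, n₀ ≤ n → ∀ A : Finset (Fin n),
    |walshSum (fun m => ArithmeticFunction.liouville m) A| <
      (2 : ℝ) ^ ((n : ℝ) - (n : ℝ) ^ ((1 : ℝ) / 10))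

/-- **Green 2012, Proposition 1 for the Liouville function** — vendored on the strength of the
printed remark (Green 2012, §1, p. 3, after Proposition 1): "All of the results in this paper hold
equally well for the Liouville function, with very similar proofs." Same shape as
`green_moebius_fourierWalsh` with `λ = ArithmeticFunction.liouville` (`λ(0) = 0`):
`|λ̂(S)| ≤ K k e^{-c n^{1/2}/k}` for `|S| = k ≥ 1`, absolute `c > 0`, `K`. This is the arithmetic
input named by route `PneNP/Mobius` for support item `Summit.PneNP.PneNP.Theses.Mobius.LiouvilleNotAC0`
(to be combined with the tree's PROVED Fourier-tail bounds for `acBasis` circuits,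
`Literature.Computability.Complexity.Circuit.l1Level_acBasis_le`, in place of Green's Theorem 2),
and the low-weight half of `bourgain_liouville_walsh_uniform`.
[cite: Green2012, Proposition 1 and §1 remark on λ] -/
def green_liouville_fourierWalsh : Prop :=
  ∃ c : ℝ, 0 < c ∧ ∃ K : ℝ, ∀ n : ℕ, 1 ≤ n → ∀ S : Finset (Fin n), S.Nonempty →
    |walshSum (fun m => ArithmeticFunction.liouville m) S| / 2 ^ n ≤
      K * S.card * Real.exp (-(c * Real.sqrt n / S.card))

end Literature.NumberTheory.LFunctions
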